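import Literature.MathematicalPhysics.QuantumFieldTheory.Balaban1983to89.LatticeFieldCalculus

/-!
# `Balaban1983to89.B3Eq28ForwardRefutation` — T. Bałaban, *(Higgs)₂,₃ quantum fields in a finite volume. III. Renormalization*,
Commun. Math. Phys. **88** (1983) 411–445 [Balaban1983Higgs3]: the display (2.8) p. 425 READ LITERALLY (last term with the FORWARD
covariant derivative `D^η_{B̃,μ}`, as printed) fails — a kernel witness on the two-site torus

statement-level skeleton of published theorems with citation tags; proofs where landed; nothing here is a claim about the Yang–Mills mass gap

PDF held: `paper:balaban1983-higgs-2-3-quantum-fields-finite-volume` (journal page = PDF page + 410); (2.8) read on the ×2 render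
`run/shared/lean/pub/pub-balaban/b2b-balaban-ref1/pages/1983-cmp88-higgs23-III/1983-cmp88-higgs23-III-p015-x2.png` (p. 425), never the OCR layer.

CITATION HEADER (lean-in-tree rule).  lit-balaban PHASE 2, seat p20, row **B3.Eq2.8-2.9**; companion of
`…Balaban1983to89.B3Eq28SummationByParts` (p243134), which PROVES (2.8) in the reading forced by the paper's own second expression
`φ′(x)·q(D^{η*}_B̃ φ′gA′)(x)`: the last term carries the BACKWARD covariant derivative `D^{η*}_{B̃,μ}`.  The page prints that term as
`−e(L^kε) Σ_x η^d Σ_μ [φ′(x)·q(D^η_{B̃,μ}φ′)(x)] g(x − ηe_μ) A′_μ(x − ηe_μ)` with the FORWARD `D^η_{B̃,μ}`, `(D^η_{B̃,μ}φ′)(x) =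
(D^η_B̃ φ′)(⟨x, x + ηe_μ⟩) = η⁻¹(U(B̃_{⟨x,x+ηe_μ⟩})φ′(x + ηe_μ) − φ′(x))` ([Balaban1983RegularityDecay] p. 572: `A_{⟨x,x+ηe_μ⟩} = A_μ(x)`;
B1 (1.7) p. 605).  WHAT IS HERE (GAPS.md G-B3-02 made first-class, PHASE2-TARGETS §G.1 "a seat that finds the typed statement FALSE as typed
files the refutation"): `not_eq28_forwardReading` — the literal display, universally quantified over exactly the data and the two printed
hypotheses of `B3Eq28SummationByParts.eq28` (`U(a)* = U(−a)`, `q` commuting with `U`), is FALSE; witness: `d = 1`, the two-site torus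
(`L = 3`, `m = K = 0`: `2·L^{m+K−j} = 2` sites), `W = ℂ` as a real inner-product space (`= ℝ²`, `N = 2`), `q = i·` (the printed `q² = −1`,
B1 p. 605), `U(a) = i^{sgn a}·` (unitary, `U(a)* = U(−a)`, commutes with `q`), `φ′ ≡ 1`, `g = 1_{x₀}`, `A′ = B̃ = 1_{⟨x₀,x₀+η⟩}`,
`η = e(L^kε) = 1`: left side `= −1`, literal right side `= 0` (`lhs_val`, `rhsForward_val`).  Nothing else is asserted; the identity that
DOES hold is `B3Eq28SummationByParts.eq28`.  Unit `lit-balaban-p20` (literature-prover-lit-balaban-p20-0), 2026-08-21; HOME/FILED.md.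
-/

open scoped BigOperators InnerProductSpace ComplexConjugate

namespace Literature.MathematicalPhysics.QuantumFieldTheory.Balaban1983to89.B3Eq28ForwardRefutation

open LatticeFieldCalculus Complex

/-! ## 1. The witness data -/

/-- The one-dimensional two-site tori of `Setup`: `d = 1`, `L = 3`, `m = K = 0` (so `T^{(j)}` has `2·L^{m+K−j} = 2` sites for every `j`).
[cite: Balaban1983Higgs3, (2.8) p.425] -/
def P2 : Params where
  d := 1
  L := 3
  m := 0
  K := 0
  hd := le_refl 1
  hL := ⟨by decide, by decide⟩

/-- The unique lattice direction of the one-dimensional tori `P2`. [cite: Balaban1983Higgs3, (2.8) p.425] -/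
def dir0 : Fin P2.d := ⟨0, P2.hd⟩

/-- The site of `T^{(0)}` (here: two points) with coordinate `a`. [cite: Balaban1983Higgs3, (2.8) p.425] -/
def site (a : ZMod (P2.sitesPerDir 0)) : Site P2 0 := fun _ => a

/-- `U(a)`: multiplication by `i^{sgn a}` on `W = ℂ ≅ ℝ²` — a family with `U(a)* = U(−a)` commuting with `q = i·` (all that `eq28` assumes of
`U`; the printed `U(A) = exp(qηeA)` is not needed for a counterexample to the LITERAL reading). [cite: Balaban1983Higgs3, (2.8) p.425] -/
noncomputable def uval (a : ℝ) : ℂ := if 0 < a then I else if a < 0 then -I else 1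

/-- `U(a)` as a real-linear map of `ℂ`. [cite: Balaban1983Higgs3, (2.8) p.425] -/
noncomputable def urep (a : ℝ) : ℂ →ₗ[ℝ] ℂ := LinearMap.mulLeft ℝ (uval a)

/-- `q = i·` (the antisymmetric charge matrix with `q² = −1`, B1 p. 605 "N = 2 and q² = −1"). [cite: Balaban1983Higgs3, (2.8) p.425] -/
noncomputable def qI : ℂ →ₗ[ℝ] ℂ := LinearMap.mulLeft ℝ I

/-- `B̃ = A′ = 1_{⟨x₀, x₀+η⟩}`: the bond variable is `1` on the bond leaving the site of coordinate `0`, else `0`. [cite: Balaban1983Higgs3, (2.8) p.425] -/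
noncomputable def bondInd : VecField P2 0 ℝ := fun b => if b.src dir0 = 0 then 1 else 0

/-- `g = 1_{x₀}`. [cite: Balaban1983Higgs3, (2.8) p.425] -/
noncomputable def siteInd : SiteField P2 0 ℝ := fun x => if x dir0 = 0 then 1 else 0

/-- `φ′ ≡ 1 ∈ ℂ`. [cite: Balaban1983Higgs3, (2.8) p.425] -/
def phiOne : SiteField P2 0 ℂ := fun _ => 1

/-! ## 2. The two printed hypotheses hold for the witness -/

/-- `conj U(a) = U(−a)`. [cite: Balaban1983Higgs3, (2.8) p.425] -/
theorem conj_uval (a : ℝ) : conj (uval a) = uval (-a) := by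
  unfold uval
  by_cases h1 : 0 < a
  · rw [if_pos h1, if_neg (by linarith), if_pos (by linarith), conj_I]
  · by_cases h2 : a < 0
    · rw [if_neg h1, if_pos h2, if_pos (by linarith), map_neg, conj_I, neg_neg]
    · have ha : a = 0 := le_antisymm (not_lt.mp h1) (not_lt.mp h2)
      subst ha
      simp

/-- `U(a)* = U(−a)` on `W = ℂ ≅ ℝ²` (the hypothesis `hU` of `eq28`). [cite: Balaban1983Higgs3, (2.8) p.425] -/
theorem urep_adj (a : ℝ) (v v' : ℂ) : ⟪urep a v, v'⟫_ℝ = ⟪v, urep (-a) v'⟫_ℝ := by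
  simp only [urep, LinearMap.mulLeft_apply, Complex.inner, map_mul, conj_uval]
  ring_nf

/-- `q` commutes with `U(a)` (the hypothesis `hq` of `eq28`). [cite: Balaban1983Higgs3, (2.8) p.425] -/
theorem qI_comm (a : ℝ) (v : ℂ) : qI (urep a v) = urep a (qI v) := by
  simp only [urep, qI, LinearMap.mulLeft_apply]
  ring

/-! ## 3. Bookkeeping on the two-site torus -/

/-- `d = 1`: every direction is `dir0`. [folklore] -/
private theorem fin_eq_dir0 (i : Fin P2.d) : i = dir0 :=
  Fin.ext (by have hi := i.isLt; change (i : ℕ) < 1 at hi; change (i : ℕ) = 0; omega)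

/-- The two sites, labelled by `Fin 2`. [folklore] -/
private def siteEquiv : Fin 2 ≃ Site P2 0 where
  toFun k := site ((k : ℕ) : ZMod (P2.sitesPerDir 0))
  invFun x := ⟨(x dir0).val, (x dir0).val_lt⟩
  left_inv k := by
    refine Fin.ext ?_
    show (((k : ℕ) : ZMod (P2.sitesPerDir 0))).val = k
    exact ZMod.val_cast_of_lt k.isLt
  right_inv x := by
    funext i
    rw [fin_eq_dir0 i]
    exact ZMod.natCast_zmod_val (x dir0)

/-- A sum over the sites of the two-point torus. [folklore] -/
private theorem sum_site (F : Site P2 0 → ℝ) : ∑ x, F x = F (site 0) + F (site 1) := by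
  rw [← Equiv.sum_comp siteEquiv F, Fin.sum_univ_two]
  simp [siteEquiv]

/-- A sum over the one direction. [folklore] -/
private theorem sum_dir (F : Fin P2.d → ℝ) : ∑ μ, F μ = F dir0 :=
  Fintype.sum_eq_single dir0 fun μ hμ => absurd (fin_eq_dir0 μ) hμ

/-- A sum over the bonds of the two-point torus (`d = 1`). [folklore] -/
private theorem sum_bond (F : PBond P2 0 → ℝ) : ∑ b, F b = F ⟨site 0, dir0⟩ + F ⟨site 1, dir0⟩ := by
  rw [← (bondEquiv (P := P2) (j := 0)).sum_comp F, Fintype.sum_prod_type, sum_site]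
  simp only [sum_dir]
  rfl

/-! ## 4. The two sides of the literal display for the witness -/

/-- Left side of (2.8) for the witness: `−e Σ_b η^d[(D^η_B̃φ′)(b)·qφ′(b₋)]g(b₋)A′_b = −⟪i·1 − 1, i·1⟫ = −1`. [cite: Balaban1983Higgs3, (2.8) p.425] -/
theorem lhs_val : -(1 : ℝ) * ∑ b : PBond P2 0, (1 : ℝ) *
    (⟪covDerivScalar 1 urep bondInd phiOne b, qI (phiOne b.src)⟫_ℝ * siteInd b.src * bondInd b) = -1 := by
  have h1 : (1 : ZMod (P2.sitesPerDir 0)) ≠ 0 := by decide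
  rw [sum_bond]
  simp [covDerivScalar, phiOne, bondInd, siteInd, site, urep, qI, uval, h1, Complex.inner]

/-- Literal right side of (2.8) for the witness (forward `D^η_{B̃,μ}` in the last term): every term vanishes (`φ′·qφ′ = 0` kills the first two,
`(D^η_{B̃}φ′)(⟨x₁, x₁+η⟩) = 1·1 − 1 = 0` and `g(x₀ − η) = 0` kill the third). [cite: Balaban1983Higgs3, (2.8) p.425] -/
theorem rhsForward_val :
    -(1 : ℝ) * ∑ x : Site P2 0, (1 : ℝ) * (⟪phiOne x, qI (phiOne x)⟫_ℝ * siteInd x * diverg 1 bondInd x)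
      - 1 * ∑ x : Site P2 0, (1 : ℝ) * (⟪phiOne x, qI (phiOne x)⟫_ℝ * ∑ μ : Fin P2.d, pdiffAdj 1 μ siteInd x * bondInd ⟨x.unshift μ, μ⟩)
      - 1 * ∑ x : Site P2 0, (1 : ℝ) * ∑ μ : Fin P2.d,
          ⟪phiOne x, qI (covDerivScalar 1 urep bondInd phiOne ⟨x, μ⟩)⟫_ℝ * siteInd (x.unshift μ) * bondInd ⟨x.unshift μ, μ⟩ = 0 := by
  have hq0 : ∀ x : Site P2 0, ⟪phiOne x, qI (phiOne x)⟫_ℝ = 0 := fun x => by simp [phiOne, qI, Complex.inner]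
  have h1 : (1 : ZMod (P2.sitesPerDir 0)) ≠ 0 := by decide
  simp only [hq0, zero_mul, mul_zero, Finset.sum_const_zero, sub_zero, sum_dir]
  rw [sum_site]
  simp [covDerivScalar, phiOne, bondInd, siteInd, site, Site.unshift, urep, qI, uval, h1, Complex.inner]

/-! ## 5. The literal display is not an identity -/

/-- **(2.8) p. 425 [PDF 15] READ LITERALLY is false.**  The display with its last term as printed, `… Σ_μ [φ′(x)·q(D^η_{B̃,μ}φ′)(x)]
g(x − ηe_μ)A′_μ(x − ηe_μ)` with the FORWARD `(D^η_{B̃,μ}φ′)(x) = (D^η_B̃φ′)(⟨x, x + ηe_μ⟩)`, quantified over exactly the data of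
`B3Eq28SummationByParts.eq28` (any torus of `Setup`, any real inner-product space `W`, any `U` with `U(a)* = U(−a)` and any `q` commuting
with `U`), fails for the witness of §1 (left side `−1`, right side `0`).  The identity that holds has `D^{η*}_{B̃,μ}` there
(`B3Eq28SummationByParts.eq28`, GAPS.md G-B3-02: a dropped asterisk in print). [cite: Balaban1983Higgs3, (2.8) p.425] -/
theorem not_eq28_forwardReading :
    ¬ ∀ (W : Type) [NormedAddCommGroup W] [InnerProductSpace ℝ W] (P : Params) (j : ℕ) (eRun w c : ℝ) (Urep : ℝ → W →ₗ[ℝ] W)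
        (q : W →ₗ[ℝ] W), (∀ (a : ℝ) (v v' : W), ⟪Urep a v, v'⟫_ℝ = ⟪v, Urep (-a) v'⟫_ℝ) →
        (∀ (a : ℝ) (v : W), q (Urep a v) = Urep a (q v)) →
        ∀ (B A : VecField P j ℝ) (g : SiteField P j ℝ) (φ : SiteField P j W),
          -eRun * ∑ b : PBond P j, w * (⟪covDerivScalar c Urep B φ b, q (φ b.src)⟫_ℝ * g b.src * A b)
            = -eRun * ∑ x : Site P j, w * (⟪φ x, q (φ x)⟫_ℝ * g x * diverg c A x)
              - eRun * ∑ x : Site P j, w * (⟪φ x, q (φ x)⟫_ℝ * ∑ μ : Fin P.d, pdiffAdj c μ g x * A ⟨x.unshift μ, μ⟩)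
              - eRun * ∑ x : Site P j, w * ∑ μ : Fin P.d,
                  ⟪φ x, q (covDerivScalar c Urep B φ ⟨x, μ⟩)⟫_ℝ * g (x.unshift μ) * A ⟨x.unshift μ, μ⟩ := by
  intro h
  have h1 := h ℂ P2 0 1 1 1 urep qI urep_adj qI_comm bondInd bondInd siteInd phiOne
  rw [lhs_val, rhsForward_val] at h1
  norm_num at h1

end Literature.MathematicalPhysics.QuantumFieldTheory.Balaban1983to89.B3Eq28ForwardRefutation
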